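import Literature.NumberTheory.PAdicHodge.BdRPlusTheta
import Literature.NumberTheory.PAdicHodge.PadicBaseField
import Mathlib.RingTheory.Henselian
import Mathlib.FieldTheory.PrimitiveElement
import Mathlib.Algebra.Polynomial.Identities
import HarnessLib

/-!
# `ℚ_p ⊆ B_dR⁺(F)` and the `Γ_F`-equivariant embedding `F ↪ B_dR⁺(F)` (Hensel)

Let `F` be a nonarchimedean local field of characteristic `0` and residue characteristic `p`.

* **Uniqueness of maps out of `ℤ_p`** (`padicInt_ringHom_ext_of_isHausdorff`): two ring maps
  `ℤ_p → R` into a `p`-adically separated ring agree. Hence `𝕎(σ♭) ∘ (ℤ_p → 𝔸_inf) = (ℤ_p → 𝔸_inf)`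
  (`galAinf_zpToAinf`) and `θ ∘ (ℤ_p → 𝔸_inf) = (ℤ_p → 𝒪_F → 𝒪_{ℂ_F})` (`fontaineTheta_zpToAinf`).
* `qpToBdR : ℚ_p → B_dR⁺(F)` (`p` is invertible in `B_dR⁺`), fixed by `Γ_F` (`galBdRPlus_qpToBdR`),
  compatible with `θ` (`thetaBdR_qpToBdR`).
* **The embedding `F ↪ B_dR⁺(F)`** (`embBdR`, for `hp : v(p) < 1`, over `K₀ = ℚ_p`): `F = K₀(α)`,
  and the minimal polynomial of `α` has a simple root in the residue field `ℂ_F ⊇ F` of the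
  complete local ring `B_dR⁺`, which lifts uniquely (Hensel, Mathlib `IsAdicComplete.henselianRing`);
  `θ ∘ embBdR = (F ⊆ ℂ_F)` (`thetaBdR_embBdR`) and **`σ ∘ embBdR = embBdR`** for all `σ ∈ Γ_F`
  (`galBdRPlus_embBdR`).

This is the `P̄ ⊆ B_dR⁺` statement of Fontaine 1994, Exp. II §1.5.3 (for `P = F`), Fontaine–Ouyang
Prop. 5.1.7.

## References
* [FontaineAsterisque223III] J.-M. Fontaine, *Le corps des périodes p-adiques*, Astérisque 223
  (1994), Exp. II, §1.5.3.
* [FontaineOuyang2022] J.-M. Fontaine, Y. Ouyang, *Theory of p-adic Galois representations*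
  (book draft), Prop. 5.1.7.
-/

noncomputable section

open ValuativeRel Field Ideal WittVector UniformSpace Polynomial
open Literature.AlgebraicGeometry.Resolution

namespace Literature.NumberTheory.PAdicHodge

open Literature.NumberTheory.GaloisRepresentations
open Literature.NumberTheory.GaloisRepresentations.IsNonarchimedeanLocalField

variable {F : Type} [Field F] [ValuativeRel F] [TopologicalSpace F] [IsNonarchimedeanLocalField F]
  {p : ℕ} [Fact p.Prime]

/-! ### Ring maps out of `ℤ_p` into `p`-adically separated rings are unique -/

omit [ValuativeRel F] [TopologicalSpace F] [IsNonarchimedeanLocalField F] in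
/-- **Two ring homomorphisms `ℤ_p → R` into a `p`-adically separated ring coincide** (modulo `pⁿ`
both kill `pⁿ`, tree `LocalField.padicInt_ringHom_ext`). [folklore] -/
theorem padicInt_ringHom_ext_of_isHausdorff {R : Type*} [CommRing R] [IsHausdorff (Ideal.span {(p : R)}) R]
    (φ ψ : ℤ_[p] →+* R) : φ = ψ := by
  refine RingHom.ext fun x => (IsHausdorff.eq_iff_smodEq (I := Ideal.span {(p : R)})).2 fun n => ?_
  rw [smul_eq_mul, Ideal.mul_top, SModEq.sub_mem, ← Ideal.Quotient.eq, ← RingHom.comp_apply, ← RingHom.comp_apply]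
  refine RingHom.congr_fun (LocalField.padicInt_ringHom_ext (n := n) _ _ ?_ ?_) x <;>
  · rw [RingHom.comp_apply, map_pow, map_natCast, Ideal.Quotient.eq_zero_iff_mem]
    exact Ideal.pow_mem_pow (Ideal.mem_span_singleton_self _) n

section Ainf

variable [Fact (¬ IsUnit (p : integerC F))]

/-- **`Γ_F` fixes `ℤ_p ⊆ 𝔸_inf(F)`.** [folklore] -/
theorem galAinf_zpToAinf (σ : absoluteGaloisGroup F) (a : ℤ_[p]) :
    galAinf σ (zpToAinf a : Ainf (p := p) F) = zpToAinf a :=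
  RingHom.congr_fun (padicInt_ringHom_ext_of_isHausdorff ((galAinf σ).comp zpToAinf) zpToAinf) a

variable [IsAdicComplete (Ideal.span {(p : integerC F)}) (integerC F)]

/-! ### `ℚ_p → B_dR⁺` -/

/-- `p` is a unit of `B_dR⁺`. [folklore] -/
theorem isUnit_ainfToBdR_natCast : IsUnit (ainfToBdR (p : Ainf (p := p) F)) := by
  change IsUnit (algebraMap _ (BDeRhamPlus (integerC F) p) (algebraMap (Ainf (p := p) F) (Localization.Away (p : Ainf (p := p) F)) p))
  exact (IsLocalization.Away.algebraMap_isUnit (p : Ainf (p := p) F)).map _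

/-- Non-zero `p`-adic integers become units in `B_dR⁺` (`x = u pᵏ`). [folklore] -/
theorem isUnit_ainfToBdR_zpToAinf (y : nonZeroDivisors ℤ_[p]) :
    IsUnit ((ainfToBdR.comp zpToAinf : ℤ_[p] →+* BDeRhamPlus (integerC F) p) y) := by
  have hy : (y : ℤ_[p]) ≠ 0 := mem_nonZeroDivisors_iff_ne_zero.1 y.2
  rw [PadicInt.unitCoeff_spec hy, map_mul, map_pow, map_natCast]
  refine IsUnit.mul ((PadicInt.unitCoeff hy).isUnit.map _) (IsUnit.pow _ ?_)
  have h := isUnit_ainfToBdR_natCast (F := F) (p := p)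
  rwa [map_natCast] at h

/-- **`ℚ_p → B_dR⁺(F)`**: the extension of `ℤ_p → 𝔸_inf → B_dR⁺` to the fraction field.
[cite: FontaineAsterisque223III, Exp. II §1.5.3] -/
def qpToBdR : ℚ_[p] →+* BDeRhamPlus (integerC F) p :=
  IsLocalization.lift (M := nonZeroDivisors ℤ_[p]) isUnit_ainfToBdR_zpToAinf

/-- `qpToBdR` on `ℤ_p`. [folklore] -/
@[simp] theorem qpToBdR_coe (x : ℤ_[p]) : qpToBdR (x : ℚ_[p]) = ainfToBdR (zpToAinf x : Ainf (p := p) F) :=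
  IsLocalization.lift_eq (M := nonZeroDivisors ℤ_[p]) isUnit_ainfToBdR_zpToAinf x

variable [CharZero F]

/-- **`Γ_F` fixes `ℚ_p ⊆ B_dR⁺`.** [cite: FontaineAsterisque223III, Exp. II §1.5.3] -/
theorem galBdRPlus_qpToBdR (σ : absoluteGaloisGroup F) (x : ℚ_[p]) :
    galBdRPlus σ (qpToBdR x : BDeRhamPlus (integerC F) p) = qpToBdR x := by
  have h : (galBdRPlus σ).comp (qpToBdR (F := F) (p := p)) = qpToBdR :=
    IsLocalization.ringHom_ext (nonZeroDivisors ℤ_[p]) (RingHom.ext fun y => by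
      simp only [RingHom.coe_comp, Function.comp_apply]
      rw [PadicInt.algebraMap_apply, qpToBdR_coe, galBdRPlus_ainfToBdR, galAinf_zpToAinf])
  exact RingHom.congr_fun h x

/-- `θ` on `ℚ_p ⊆ B_dR⁺`, integral case. [folklore] -/
theorem thetaBdR_qpToBdR_coe (x : ℤ_[p]) :
    thetaBdR (qpToBdR (x : ℚ_[p]) : BDeRhamPlus (integerC F) p) =
      ((fontaineTheta (integerC F) p (zpToAinf x) : integerC F) : CompletedAlgClosure F) := by
  rw [qpToBdR_coe, thetaBdR_ainfToBdR]

end Ainf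

/-! ### With `hp : v(p) < 1`: compatibility with `ℚ_p = K₀ ⊆ F ⊆ ℂ_F` -/

section Base

variable [CharZero F] (hp : valuation F p < 1)

/-- `ℤ_p → 𝒪_{ℂ_F}` through `K₀ = ℚ_p ⊆ F ⊆ ℂ_F`. [folklore] -/
def toIntC : ℤ_[p] →+* integerC F :=
  ((algebraMap F (CompletedAlgClosure F)).comp ((algebraMap (PadicBase F p hp) F).comp (PadicBase.ofPadicInt hp))).codRestrict
    (integerC F) fun z => by
      rw [mem_integerC_iff, RingHom.comp_apply, RingHom.comp_apply, CompletedAlgClosure.norm_algebraMap,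
        PadicBase.norm_algebraMap]
      exact PadicBase.norm_ofPadicInt_le_one hp z

/-- Unfolding of `toIntC`. [folklore] -/
theorem coe_toIntC (z : ℤ_[p]) :
    ((toIntC hp z : integerC F) : CompletedAlgClosure F) =
      algebraMap F (CompletedAlgClosure F) (algebraMap (PadicBase F p hp) F (PadicBase.ofPadicInt hp z)) := rfl

/-! ### Ring maps out of `F` are determined on `K₀` and on a primitive element -/

/-- Two ring maps `F → S` agreeing on `K₀` and on the generator of a power basis agree. [folklore] -/
theorem ringHom_ext_powerBasis {S : Type*} [Semiring S] (pb : PowerBasis (PadicBase F p hp) F) (φ ψ : F →+* S)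
    (h0 : φ.comp (algebraMap (PadicBase F p hp) F) = ψ.comp (algebraMap (PadicBase F p hp) F))
    (hgen : φ pb.gen = ψ pb.gen) : φ = ψ := by
  refine RingHom.ext fun x => ?_
  obtain ⟨q, rfl⟩ := pb.exists_eq_aeval' x
  rw [aeval_def, hom_eval₂, hom_eval₂, h0, hgen]

/-- A power basis of `F` over `K₀` (primitive element theorem; `F/K₀` finite separable).
[folklore] -/
def basePowerBasis : PowerBasis (PadicBase F p hp) F :=
  Field.powerBasisOfFiniteOfSeparable (PadicBase F p hp) F

/-- The polynomial over `ℂ_F` evaluated at (the image of) `x ∈ F` is the image of `aeval x`. [folklore] -/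
theorem eval_map_algebraMap (q : (PadicBase F p hp)[X]) (x : F) :
    (q.map ((algebraMap F (CompletedAlgClosure F)).comp (algebraMap (PadicBase F p hp) F))).eval
        (algebraMap F (CompletedAlgClosure F) x) =
      algebraMap F (CompletedAlgClosure F) (aeval x q) := by
  rw [eval_map, ← hom_eval₂, ← aeval_def]

variable [Fact (¬ IsUnit (p : integerC F))] [IsAdicComplete (Ideal.span {(p : integerC F)}) (integerC F)]

/-- **`θ ∘ (ℤ_p → 𝔸_inf) = (ℤ_p → 𝒪_{ℂ_F})`** (uniqueness of maps out of `ℤ_p`). [folklore] -/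
theorem fontaineTheta_zpToAinf (x : ℤ_[p]) :
    fontaineTheta (integerC F) p (zpToAinf x : Ainf (p := p) F) = toIntC hp x :=
  RingHom.congr_fun (padicInt_ringHom_ext_of_isHausdorff ((fontaineTheta (integerC F) p).comp zpToAinf) (toIntC hp)) x

/-- **`θ ∘ (ℚ_p → B_dR⁺) = (ℚ_p ⊆ F ⊆ ℂ_F)`.** [cite: FontaineAsterisque223III, Exp. II §1.5.3] -/
theorem thetaBdR_qpToBdR (x : ℚ_[p]) :
    thetaBdR (qpToBdR x : BDeRhamPlus (integerC F) p) =
      algebraMap F (CompletedAlgClosure F) (algebraMap (PadicBase F p hp) F ((PadicBase.toPadic hp).symm x)) := by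
  have h : (thetaBdR (F := F) (p := p)).comp qpToBdR =
      (algebraMap F (CompletedAlgClosure F)).comp ((algebraMap (PadicBase F p hp) F).comp
        (PadicBase.toPadic hp).symm.toRingHom) :=
    IsLocalization.ringHom_ext (nonZeroDivisors ℤ_[p]) (RingHom.ext fun y => by
      simp only [RingHom.coe_comp, Function.comp_apply]
      rw [PadicInt.algebraMap_apply, thetaBdR_qpToBdR_coe, fontaineTheta_zpToAinf hp, coe_toIntC]
      rfl)
  exact RingHom.congr_fun h x

/-- **`B_dR⁺(F)` as a `K₀ = ℚ_p`-algebra** (to be installed with `letI`). [cite: FontaineAsterisque223III, Exp. II §1.5.3] -/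
abbrev baseAlgebraBdR : Algebra (PadicBase F p hp) (BDeRhamPlus (integerC F) p) :=
  ((qpToBdR (F := F) (p := p)).comp (PadicBase.toPadic hp).toRingHom).toAlgebra

omit [CharZero F] in
/-- Unfolding of the `K₀`-algebra structure. [folklore] -/
theorem algebraMap_baseAlgebraBdR (c : PadicBase F p hp) :
    (letI := baseAlgebraBdR hp; algebraMap (PadicBase F p hp) (BDeRhamPlus (integerC F) p) c) =
      qpToBdR (PadicBase.toPadic hp c) := rfl

/-- `θ` on `K₀ ⊆ B_dR⁺`. [folklore] -/
theorem thetaBdR_algebraMap_base (c : PadicBase F p hp) :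
    (letI := baseAlgebraBdR hp; thetaBdR (algebraMap (PadicBase F p hp) (BDeRhamPlus (integerC F) p) c)) =
      algebraMap F (CompletedAlgClosure F) (algebraMap (PadicBase F p hp) F c) := by
  rw [algebraMap_baseAlgebraBdR, thetaBdR_qpToBdR hp]; rfl

/-- `Γ_F` fixes `K₀ ⊆ B_dR⁺`. [folklore] -/
theorem galBdRPlus_algebraMap_base (σ : absoluteGaloisGroup F) (c : PadicBase F p hp) :
    (letI := baseAlgebraBdR hp; galBdRPlus σ (algebraMap (PadicBase F p hp) (BDeRhamPlus (integerC F) p) c)) =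
      (letI := baseAlgebraBdR hp; algebraMap (PadicBase F p hp) (BDeRhamPlus (integerC F) p) c) := by
  rw [algebraMap_baseAlgebraBdR, galBdRPlus_qpToBdR]

/-! ### The Hensel lift -/

/-- The minimal polynomial of the primitive element, base-changed to `B_dR⁺`. [folklore] -/
def minpolyBdR : (BDeRhamPlus (integerC F) p)[X] :=
  letI := baseAlgebraBdR (F := F) hp
  (minpoly (PadicBase F p hp) (basePowerBasis hp).gen).map (algebraMap (PadicBase F p hp) (BDeRhamPlus (integerC F) p))

/-- `θ` of a base-changed polynomial evaluated at `b` is the polynomial over `ℂ_F` evaluated at `θ b`.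
[folklore] -/
theorem thetaBdR_eval_map (q : (PadicBase F p hp)[X]) (b : BDeRhamPlus (integerC F) p) :
    letI := baseAlgebraBdR (F := F) hp
    thetaBdR ((q.map (algebraMap (PadicBase F p hp) (BDeRhamPlus (integerC F) p))).eval b) =
      (q.map ((algebraMap F (CompletedAlgClosure F)).comp (algebraMap (PadicBase F p hp) F))).eval (thetaBdR b) := by
  letI := baseAlgebraBdR (F := F) hp
  rw [eval_map, hom_eval₂, eval_map]
  congr 1
  refine RingHom.ext fun c => ?_
  rw [RingHom.comp_apply, thetaBdR_algebraMap_base]; rfl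

/-- `θ(g(b)) = 0` whenever `θ b = α` (`g` the minimal polynomial of `α`). [folklore] -/
theorem thetaBdR_eval_minpolyBdR {b : BDeRhamPlus (integerC F) p}
    (hb : thetaBdR b = algebraMap F (CompletedAlgClosure F) (basePowerBasis hp).gen) :
    thetaBdR ((minpolyBdR hp).eval b) = 0 := by
  rw [minpolyBdR, thetaBdR_eval_map, hb, eval_map_algebraMap, minpoly.aeval, map_zero]

/-- `θ(g'(b)) ≠ 0` whenever `θ b = α` (`α` is a simple root: `F/K₀` is separable). [folklore] -/
theorem thetaBdR_eval_derivative_minpolyBdR_ne_zero {b : BDeRhamPlus (integerC F) p}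
    (hb : thetaBdR b = algebraMap F (CompletedAlgClosure F) (basePowerBasis hp).gen) :
    thetaBdR ((minpolyBdR hp).derivative.eval b) ≠ 0 := by
  rw [minpolyBdR, derivative_map, thetaBdR_eval_map, hb, eval_map_algebraMap,
    map_ne_zero_iff _ (algebraMap F (CompletedAlgClosure F)).injective]
  exact (Algebra.IsSeparable.isSeparable (PadicBase F p hp) (basePowerBasis hp).gen).aeval_derivative_ne_zero
    (minpoly.aeval _ _)

/-- **Uniqueness of simple roots with given reduction** in `B_dR⁺`: two roots of `f` with the same
image under `θ`, at which `θ(f') ≠ 0`, are equal (`f(a') = f(a) + f'(a)(a'−a) + k(a'−a)²`).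
[cite: FontaineOuyang2022, Prop. 5.1.7] -/
theorem root_unique (hF : Function.Surjective (fontaineTheta (integerC F) p))
    (f : (BDeRhamPlus (integerC F) p)[X]) {a a' : BDeRhamPlus (integerC F) p}
    (ha : f.eval a = 0) (ha' : f.eval a' = 0) (hθ : thetaBdR a' = thetaBdR a)
    (hder : thetaBdR (f.derivative.eval a) ≠ 0) : a' = a := by
  obtain ⟨k, hk⟩ := f.binomExpansion a (a' - a)
  rw [add_sub_cancel, ha', ha, zero_add] at hk
  -- `0 = (a' - a) * (f'(a) + k (a' - a))`, second factor a unit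
  have hunit : IsUnit (f.derivative.eval a + k * (a' - a)) := by
    rw [isUnit_iff_thetaBdR_ne_zero hF, map_add, map_mul, map_sub, hθ, sub_self, mul_zero, add_zero]
    exact hder
  have h0 : (a' - a) * (f.derivative.eval a + k * (a' - a)) = 0 := by rw [hk]; ring
  exact sub_eq_zero.1 ((hunit.mul_left_eq_zero).1 h0)

/-- **Hensel**: the minimal polynomial of the primitive element `α` of `F/K₀` has a root `a ∈ B_dR⁺`
with `θ(a) = α` (`B_dR⁺` is complete for its maximal ideal `ker θ`, Mathlib
`IsAdicComplete.henselianRing`). [cite: FontaineAsterisque223III, Exp. II §1.5.3] [cite: FontaineOuyang2022, Prop. 5.1.7] -/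
theorem exists_root_minpolyBdR (hF : Function.Surjective (fontaineTheta (integerC F) p)) :
    ∃ a : BDeRhamPlus (integerC F) p, (minpolyBdR hp).eval a = 0 ∧
      thetaBdR a = algebraMap F (CompletedAlgClosure F) (basePowerBasis hp).gen := by
  letI := baseAlgebraBdR (F := F) hp
  set I : Ideal (BDeRhamPlus (integerC F) p) := (RingHom.ker (fontaineThetaInvertP (integerC F) p)).map
      (algebraMap (Localization.Away (p : Ainf (p := p) F)) (BDeRhamPlus (integerC F) p)) with hI
  haveI : IsAdicComplete I (BDeRhamPlus (integerC F) p) := isAdicComplete_bDeRhamPlus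
  have hIspan : I = Ideal.span {(xiBdR : BDeRhamPlus (integerC F) p)} := map_ker_eq_span_xiBdR
  obtain ⟨a₀, ha₀⟩ := thetaBdR_surjective hF (algebraMap F (CompletedAlgClosure F) (basePowerBasis hp).gen)
  have hgm : (minpolyBdR hp : (BDeRhamPlus (integerC F) p)[X]).Monic :=
    (minpoly.monic (Algebra.IsIntegral.isIntegral _)).map _
  have h1 : (minpolyBdR hp).eval a₀ ∈ I := by
    rw [hIspan, ← mem_ker_thetaBdR_iff]; exact thetaBdR_eval_minpolyBdR hp ha₀
  have h2 : IsUnit (Ideal.Quotient.mk I ((minpolyBdR hp).derivative.eval a₀)) :=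
    ((isUnit_iff_thetaBdR_ne_zero hF _).2 (thetaBdR_eval_derivative_minpolyBdR_ne_zero hp ha₀)).map _
  obtain ⟨a, ha, haa₀⟩ := HenselianRing.is_henselian (minpolyBdR hp) hgm a₀ h1 h2
  refine ⟨a, ha, ?_⟩
  rw [hIspan, ← mem_ker_thetaBdR_iff, map_sub, sub_eq_zero] at haa₀
  rw [haa₀, ha₀]

/-- The chosen Hensel root `α̃ ∈ B_dR⁺` of the minimal polynomial of `α`. [folklore] -/
def rootBdR (hF : Function.Surjective (fontaineTheta (integerC F) p)) : BDeRhamPlus (integerC F) p :=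
  (exists_root_minpolyBdR hp hF).choose

/-- `g(α̃) = 0`. [folklore] -/
theorem eval_rootBdR (hF : Function.Surjective (fontaineTheta (integerC F) p)) :
    (minpolyBdR hp).eval (rootBdR hp hF) = 0 :=
  (exists_root_minpolyBdR hp hF).choose_spec.1

/-- `θ(α̃) = α`. [folklore] -/
theorem thetaBdR_rootBdR (hF : Function.Surjective (fontaineTheta (integerC F) p)) :
    thetaBdR (rootBdR hp hF) = algebraMap F (CompletedAlgClosure F) (basePowerBasis hp).gen :=
  (exists_root_minpolyBdR hp hF).choose_spec.2

/-- `α̃` is a root of the minimal polynomial in the `aeval` form. [folklore] -/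
theorem aeval_rootBdR (hF : Function.Surjective (fontaineTheta (integerC F) p)) :
    letI := baseAlgebraBdR (F := F) hp
    aeval (rootBdR hp hF) (minpoly (PadicBase F p hp) (basePowerBasis hp).gen) = 0 := by
  letI := baseAlgebraBdR (F := F) hp
  rw [aeval_def, ← eval_map]; exact eval_rootBdR hp hF

/-- **The embedding `F ↪ B_dR⁺(F)`** over `K₀ = ℚ_p`: `α ↦ α̃` (power basis lift).
[cite: FontaineAsterisque223III, Exp. II §1.5.3] [cite: FontaineOuyang2022, Prop. 5.1.7] -/
def embBdR (hF : Function.Surjective (fontaineTheta (integerC F) p)) :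
    letI := baseAlgebraBdR (F := F) hp
    F →ₐ[PadicBase F p hp] BDeRhamPlus (integerC F) p :=
  letI := baseAlgebraBdR (F := F) hp
  (basePowerBasis hp).lift (rootBdR hp hF) (aeval_rootBdR hp hF)

/-- **`F ↪ B_dR⁺(F)` as a ring homomorphism.** [cite: FontaineAsterisque223III, Exp. II §1.5.3] -/
def embBdRHom (hF : Function.Surjective (fontaineTheta (integerC F) p)) : F →+* BDeRhamPlus (integerC F) p :=
  letI := baseAlgebraBdR (F := F) hp
  (embBdR hp hF).toRingHom

/-- `embBdRHom` on the primitive element. [folklore] -/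
theorem embBdRHom_gen (hF : Function.Surjective (fontaineTheta (integerC F) p)) :
    embBdRHom hp hF (basePowerBasis hp).gen = rootBdR hp hF := by
  letI := baseAlgebraBdR (F := F) hp
  exact (basePowerBasis hp).lift_gen _ _

/-- `embBdRHom` on `K₀`. [folklore] -/
theorem embBdRHom_algebraMap (hF : Function.Surjective (fontaineTheta (integerC F) p)) (c : PadicBase F p hp) :
    embBdRHom hp hF (algebraMap (PadicBase F p hp) F c) = qpToBdR (PadicBase.toPadic hp c) := by
  letI := baseAlgebraBdR (F := F) hp
  exact (embBdR hp hF).commutes c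

/-- **`θ ∘ (F ↪ B_dR⁺) = (F ⊆ ℂ_F)`.** [cite: FontaineAsterisque223III, Exp. II §1.5.3] -/
theorem thetaBdR_embBdRHom (hF : Function.Surjective (fontaineTheta (integerC F) p)) (x : F) :
    thetaBdR (embBdRHom hp hF x) = algebraMap F (CompletedAlgClosure F) x := by
  have h : (thetaBdR (F := F) (p := p)).comp (embBdRHom hp hF) = algebraMap F (CompletedAlgClosure F) := by
    refine ringHom_ext_powerBasis hp (basePowerBasis hp) _ _ (RingHom.ext fun c => ?_) ?_
    · simp only [RingHom.coe_comp, Function.comp_apply]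
      rw [embBdRHom_algebraMap, thetaBdR_qpToBdR hp]; rfl
    · rw [RingHom.comp_apply, embBdRHom_gen, thetaBdR_rootBdR]
  exact RingHom.congr_fun h x

/-- `Γ_F` permutes the roots of the base-changed minimal polynomial. [folklore] -/
theorem eval_minpolyBdR_galBdRPlus (σ : absoluteGaloisGroup F) (a : BDeRhamPlus (integerC F) p) :
    (minpolyBdR hp).eval (galBdRPlus σ a) = galBdRPlus σ ((minpolyBdR hp).eval a) := by
  letI := baseAlgebraBdR (F := F) hp
  have hfix : (galBdRPlus σ).comp (algebraMap (PadicBase F p hp) (BDeRhamPlus (integerC F) p)) =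
      algebraMap (PadicBase F p hp) (BDeRhamPlus (integerC F) p) :=
    RingHom.ext fun c => galBdRPlus_algebraMap_base hp σ c
  have h := hom_eval₂ (minpolyBdR hp) (RingHom.id _) (galBdRPlus σ) a
  rw [RingHom.comp_id, eval₂_id, ← eval_map] at h
  rw [h, minpolyBdR, Polynomial.map_map, hfix]

/-- **`F ↪ B_dR⁺(F)` is `Γ_F`-equivariant: `σ ∘ embBdR = embBdR`** (`σ(α̃)` is again a root lifting
`α`, hence `= α̃` by uniqueness). [cite: FontaineAsterisque223III, Exp. II §1.5.3] [cite: FontaineOuyang2022, Prop. 5.1.7] -/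
theorem galBdRPlus_embBdRHom (hF : Function.Surjective (fontaineTheta (integerC F) p)) (σ : absoluteGaloisGroup F) (x : F) :
    galBdRPlus σ (embBdRHom hp hF x) = embBdRHom hp hF x := by
  have hroot : galBdRPlus σ (rootBdR hp hF) = rootBdR hp hF := by
    refine root_unique hF (minpolyBdR hp) (eval_rootBdR hp hF) ?_ ?_
      (thetaBdR_eval_derivative_minpolyBdR_ne_zero hp (thetaBdR_rootBdR hp hF))
    · rw [eval_minpolyBdR_galBdRPlus, eval_rootBdR, map_zero]
    · rw [thetaBdR_galBdRPlus, thetaBdR_rootBdR, CompletedAlgClosure.smul_algebraMap]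
  have h : (galBdRPlus σ).comp (embBdRHom hp hF) = embBdRHom hp hF := by
    refine ringHom_ext_powerBasis hp (basePowerBasis hp) _ _ (RingHom.ext fun c => ?_) ?_
    · simp only [RingHom.coe_comp, Function.comp_apply]
      rw [embBdRHom_algebraMap, galBdRPlus_qpToBdR]
    · rw [RingHom.comp_apply, embBdRHom_gen, hroot]
  exact RingHom.congr_fun h x

/-- `σ • embBdR x = embBdR x`. [cite: FontaineAsterisque223III, Exp. II §1.5.3] -/
theorem smul_embBdRHom (hF : Function.Surjective (fontaineTheta (integerC F) p)) (σ : absoluteGaloisGroup F) (x : F) :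
    σ • embBdRHom hp hF x = embBdRHom hp hF x :=
  galBdRPlus_embBdRHom hp hF σ x

/-- `embBdRHom` is injective (a ring map out of a field). [folklore] -/
theorem embBdRHom_injective (hF : Function.Surjective (fontaineTheta (integerC F) p)) :
    Function.Injective (embBdRHom hp hF) :=
  haveI : Nontrivial (BDeRhamPlus (integerC F) p) := ⟨⟨0, 1, fun h => by
    have := congrArg thetaBdR h; rw [map_zero, map_one] at this; exact zero_ne_one this⟩⟩
  (embBdRHom hp hF).injective

end Base

end Literature.NumberTheory.PAdicHodge

end
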